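import Mathlib.LinearAlgebra.QuadraticForm.Radical
import Mathlib.LinearAlgebra.QuadraticForm.IsometryEquiv
import Mathlib.LinearAlgebra.Matrix.BilinearForm
import Mathlib.LinearAlgebra.Basis.VectorSpace
import Mathlib.Algebra.BigOperators.Fin

/-!
# Route `SymPencil` — a quadratic form with a radical of codimension `≤ d` is a sum of `d`
# weighted squares of linear functionals
# (linear-algebra core of the rung `sdc(per_4) ≥ 21`, line `box-four`, stub `stub_defectForm`;
# `--supports` stmt-ValiantsHypothesis-5674 `SdcSuperquadratic`)

Pure linear algebra over a field of characteristic `0`.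

* `exists_pad_sum_sq`: a sum of `n ≤ d` weighted squares of linear functionals is a sum of `d`
  weighted squares (pad with zero weights).
* `exists_sum_sq_of_le_radical`: if `N ≤ rad Q` and `dim M ≤ dim N + d` then
  `Q x = Σ_{j<d} c_j ℓ_j(x)²` for constants `c_j` and linear functionals `ℓ_j` on `M`
  (diagonalise the lift of `Q` to `M ⧸ N`, `Mathlib`'s `QuadraticMap.lift` and
  `QuadraticForm.equivalent_weightedSumSquares`, and pad).
* `exists_sum_sq_on_subspace`: matrix form — for a symmetric matrix `S` and subspaces `N ≤ P` of
  `K^ι` with `N` `S`-orthogonal to `P` and `dim P ≤ dim N + d`, the form `t ↦ tᵀ S t` on `P` is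
  `Σ_{j<d} c_j ℓ_j(t)²` with `ℓ_j` linear functionals on the whole `K^ι`.

This is the `δ ≤ d` generalisation of the one-square step (`δ ≤ 1`) inside
`SymPencilIsotropicKernelDefect.sq_of_isotropic_defect_le_one`. [folklore]
-/

noncomputable section

-- single-conjunct layout: Sub = Summit, duplicated namespace component intended
set_option linter.dupNamespace false

namespace Summit.ValiantsHypothesis.ValiantsHypothesis.Theorems.SymPencilRadicalSumSquares

open Matrix Module

universe u

variable {K : Type u} [Field K]

/-- Padding a sum of `n ≤ d` weighted squares of linear functionals to `d` terms (zero weights).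
[folklore] -/
theorem exists_pad_sum_sq {M : Type*} [AddCommGroup M] [Module K M] {n d : ℕ} (hnd : n ≤ d)
    (w : Fin n → K) (ℓ : Fin n → (M →ₗ[K] K)) :
    ∃ (c : Fin d → K) (ℓ' : Fin d → (M →ₗ[K] K)),
      ∀ x, ∑ i, w i * (ℓ i x) ^ 2 = ∑ j, c j * (ℓ' j x) ^ 2 := by
  obtain ⟨e, rfl⟩ := Nat.exists_eq_add_of_le hnd
  refine ⟨Fin.append w 0, Fin.append ℓ 0, fun x => ?_⟩
  rw [Fin.sum_univ_add]
  simp only [Fin.append_left, Fin.append_right, Pi.zero_apply, LinearMap.zero_apply,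
    zero_mul, Finset.sum_const_zero, add_zero]

/-- **A quadratic form whose radical has codimension `≤ d` is a sum of `d` weighted squares of
linear functionals** (characteristic `0`): if `N ≤ rad Q` and `dim M ≤ dim N + d`, then
`Q x = Σ_{j<d} c_j ℓ_j(x)²`. [folklore] -/
theorem exists_sum_sq_of_le_radical [CharZero K] {M : Type*} [AddCommGroup M] [Module K M]
    [FiniteDimensional K M] (Q : QuadraticForm K M) (N : Submodule K M) (hN : N ≤ Q.radical)
    (d : ℕ) (hd : finrank K M ≤ finrank K N + d) :
    ∃ (c : Fin d → K) (ℓ : Fin d → (M →ₗ[K] K)), ∀ x, Q x = ∑ j, c j * (ℓ j x) ^ 2 := by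
  classical
  haveI : Invertible (2 : K) := invertibleOfNonzero two_ne_zero
  obtain ⟨w, ⟨e⟩⟩ := QuadraticForm.equivalent_weightedSumSquares (Q.lift N hN)
  have hn : finrank K (M ⧸ N) ≤ d := by
    have := N.finrank_quotient_add_finrank
    omega
  let ℓ : Fin (finrank K (M ⧸ N)) → (M →ₗ[K] K) := fun i =>
    (LinearMap.proj i) ∘ₗ (e : (M ⧸ N) ≃ₗ[K] (Fin (finrank K (M ⧸ N)) → K)).toLinearMap ∘ₗ N.mkQ
  have hℓ : ∀ i x, ℓ i x = e (N.mkQ x) i := fun i x => rfl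
  have hQ : ∀ x, Q x = ∑ i, w i * (ℓ i x) ^ 2 := by
    intro x
    rw [← QuadraticMap.lift_mk hN x, ← Submodule.mkQ_apply, ← e.map_app,
      QuadraticMap.weightedSumSquares_apply]
    exact Finset.sum_congr rfl fun i _ => by rw [hℓ, smul_eq_mul, pow_two]
  obtain ⟨c, ℓ', h⟩ := exists_pad_sum_sq hn w ℓ
  exact ⟨c, ℓ', fun x => by rw [hQ, h]⟩

/-- **Matrix form.**  For a symmetric `S` and subspaces `N ≤ P` of `K^ι` with `N` `S`-orthogonal
to `P` and `dim P ≤ dim N + d`, the quadratic form `t ↦ tᵀ S t` on `P` is a sum of `d` weighted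
squares of linear functionals on `K^ι`. [folklore] -/
theorem exists_sum_sq_on_subspace [CharZero K] {ι : Type*} [Fintype ι] [DecidableEq ι]
    (S : Matrix ι ι K) (hS : Sᵀ = S) (P N : Submodule K (ι → K)) (hNP : N ≤ P)
    (hrad : ∀ t₀ ∈ N, ∀ t ∈ P, t₀ ⬝ᵥ S *ᵥ t = 0) (d : ℕ)
    (hd : finrank K P ≤ finrank K N + d) :
    ∃ (c : Fin d → K) (ℓ : Fin d → ((ι → K) →ₗ[K] K)),
      ∀ t ∈ P, t ⬝ᵥ S *ᵥ t = ∑ j, c j * (ℓ j t) ^ 2 := by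
  classical
  have hsym : ∀ v w : ι → K, v ⬝ᵥ S *ᵥ w = w ⬝ᵥ S *ᵥ v := fun v w => by
    rw [Matrix.dotProduct_mulVec, ← Matrix.mulVec_transpose, hS, dotProduct_comm]
  -- the quadratic form `t ↦ tᵀ S t` restricted to `P`
  let Q : QuadraticForm K P := ((Matrix.toBilin' S).toQuadraticMap).comp P.subtype
  have hQ : ∀ t : P, Q t = (t : ι → K) ⬝ᵥ S *ᵥ (t : ι → K) := fun t => by
    change Matrix.toBilin' S _ _ = _
    rw [Matrix.toBilin'_apply']
    rfl
  -- `N`, seen inside `P`, lies in the radical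
  let N' : Submodule K P := N.comap P.subtype
  have hN'dim : finrank K N' = finrank K N :=
    (Submodule.comapSubtypeEquivOfLe hNP).finrank_eq
  have hN'rad : N' ≤ Q.radical := by
    intro t₀ ht₀
    have ht₀N : (t₀ : ι → K) ∈ N := ht₀
    have hinv : ∀ t : P, Q (t₀ + t) = Q t := fun t => by
      rw [hQ, hQ, Submodule.coe_add, Matrix.mulVec_add, dotProduct_add, add_dotProduct,
        add_dotProduct, hrad _ ht₀N _ (hNP ht₀N), hrad _ ht₀N _ t.2, hsym (t : ι → K),
        hrad _ ht₀N _ t.2, zero_add, zero_add, zero_add]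
    rw [QuadraticMap.mem_radical_iff']
    refine ⟨?_, hinv⟩
    have h := hinv 0
    rwa [add_zero, map_zero] at h
  have hd' : finrank K P ≤ finrank K N' + d := by rw [hN'dim]; exact hd
  obtain ⟨c, ℓP, hc⟩ := exists_sum_sq_of_le_radical Q N' hN'rad d hd'
  -- extend the functionals from `P` to `K^ι`
  choose g hg using fun j => LinearMap.exists_extend (ℓP j)
  refine ⟨c, g, fun t ht => ?_⟩
  rw [← hQ ⟨t, ht⟩, hc]
  exact Finset.sum_congr rfl fun j _ => by rw [← hg j, LinearMap.comp_apply, Submodule.subtype_apply]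

end Summit.ValiantsHypothesis.ValiantsHypothesis.Theorems.SymPencilRadicalSumSquares

end
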